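import Mathlib
import Summits.Ventures.PercRepro2.Defs
import Summits.Ventures.PercRepro2.Graph
import Summits.Ventures.PercRepro2.OneColourSwitch
import Summits.Ventures.PercRepro2.RegionHubSign
import Summits.Ventures.PercRepro2.SideSwitch
import Summits.Ventures.PercRepro2.TermSwitchDefs
import Summits.Ventures.PercRepro2.M9NoPocketDefs
import Summits.Ventures.PercRepro2.M9PsiOneDefs
import Summits.Ventures.PercRepro2.M9PsiOneWorlds
import Summits.Ventures.PercRepro2.M9PsiOneLink
import Summits.Ventures.PercRepro2.M9PsiOneInj
import Summits.Ventures.PercRepro2.M9PsiTwoDefs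
import Summits.Ventures.PercRepro2.M9PsiTwoWorlds
import Summits.Ventures.PercRepro2.M9PsiTwoNoLink

/-!
# The `Y`-link of the second partner `Ψ₂ ω`: `σ_rs(Ψ₂ ω) = +1` (blind cell PercRepro2, p3 g34,
2026-08-29; `proofs/P3-REST2.md` §1, claim (ii))

For an `EX` colouring `ω` with `r ~_W s` and no edge `r–s`, `Ψ₂ ω` HAS a `Y`-link: in the
non-pure case a `W`-linking block of `ω` becomes `Y`-linking (`conn_psiTwo_of_linkingW`); in the
pure case the `W`-link of `ω` runs through `d`, so `d` has `W`-neighbours rooted at `r` and at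
`s` inside their blocks (`exists_rooted_nbr`, `exists_rooted_nbr_s`), the one rooted at
`oppRoot` gets its `d`-edge flipped to `Y` and is `Y`-connected to `oppRoot` in `Ψ₂ ω`, while
`d` stays `Y`-connected to its own root (`conn_psiTwo_of_conn` of `M9PsiTwoNoLink`): `r ~_Y s`
through `d` (`conn_psiTwo_of_pure`).  With `not_conn_compl_psiTwo` (`M9PsiTwoNoLink`):
**`sigma (Ψ₂ ω) r s = 1`** (`sigma_psiTwo_rs`).  Own work; std axioms.
-/

namespace Summit.Ventures.PercRepro2

namespace NoPocket

open Finset Classical RegionHub OneColourSwitch SideSwitch TermSwitch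

variable {V : Type*} {E : Type*}

section Link

variable {ends : E → Sym2 V} {p q r s d : V} {ω : Config E}

variable (h : IsEX ends p q r s d ω)
include h

/-- On the edges inside the block of a flipped vertex together with `{r, s}`, `Ψ₂ ω` is the
colour flip of `ω` (no edge `r–s`). -/
lemma psiTwo_eq_not_on_block (hrs : ∀ e, ends e ≠ s(r, s)) {x : V}
    (hx : x ∈ flipSetW ends r s d ω) :
    ∀ e a b, a ≠ b → a ∈ blockIn ends (Mcore ends r s d ω) x ∪ {r, s} →
      b ∈ blockIn ends (Mcore ends r s d ω) x ∪ {r, s} → ends e = s(a, b) →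
      OneColourSwitch.compl ω e = psiTwo ends r s d ω e := by
  intro e a b hab ha hb hends
  have hxM := flipSetW_subset_Mcore hx
  rcases ha with ha | ha <;> rcases hb with hb | hb
  · -- both inside the block
    have haF := blockIn_subset_flipSetW hx ha
    have hbM := mem_Mcore_of_mem_blockIn hxM hb
    rw [psiTwo_inside haF hends hbM]; rfl
  · -- `a` in the block, `b` a terminal
    have haF := blockIn_subset_flipSetW hx ha
    simp only [Set.mem_insert_iff, Set.mem_singleton_iff] at hb
    rw [psiTwo_flip_term haF hb hends h.hr h.hs]; rfl
  · -- `a` a terminal, `b` in the block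
    have hbF := blockIn_subset_flipSetW hx hb
    simp only [Set.mem_insert_iff, Set.mem_singleton_iff] at ha
    rw [psiTwo_flip_term hbF ha (ends_swap hends) h.hr h.hs]; rfl
  · -- both terminals: an edge `r–s`, excluded
    exfalso
    simp only [Set.mem_insert_iff, Set.mem_singleton_iff] at ha hb
    rcases ha with rfl | rfl <;> rcases hb with rfl | rfl
    · exact hab rfl
    · exact hrs e hends
    · exact hrs e (ends_swap hends)
    · exact hab rfl

/-- **The non-pure case**: a `W`-linking vertex of `ω` gives a `Y`-link of `Ψ₂ ω`. -/
theorem conn_psiTwo_of_linkingW (hrs : ∀ e, ends e ≠ s(r, s)) {x : V}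
    (hx : linkingW ends r s d ω x) : Conn ends (psiTwo ends r s d ω) r s := by
  have hc : Conn ends (restrictTo ends (psiTwo ends r s d ω)
      (blockIn ends (Mcore ends r s d ω) x ∪ {r, s})) r s :=
    conn_restrictTo_transfer (psiTwo_eq_not_on_block h hrs (Or.inr hx)) hx.2
  refine conn_mono ?_ hc
  intro e
  unfold restrictTo
  split_ifs <;> simp

/-- A vertex rooted at `t` inside the block of a flipped vertex is `Y`-connected to `t` in
`Ψ₂ ω` (no edge `r–s`). -/
lemma conn_psiTwo_of_rootedW (hrs : ∀ e, ends e ≠ s(r, s)) {t x : V}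
    (hx : x ∈ flipSetW ends r s d ω) (hr : rootedW ends r s d ω t x) :
    Conn ends (psiTwo ends r s d ω) t x := by
  have hc : Conn ends (restrictTo ends (psiTwo ends r s d ω)
      (blockIn ends (Mcore ends r s d ω) x ∪ {r, s})) t x :=
    conn_restrictTo_transfer (psiTwo_eq_not_on_block h hrs hx) hr.2
  refine conn_mono ?_ hc
  intro e
  unfold restrictTo
  split_ifs <;> simp

/-- **The pure case, the rooted neighbours**: if `r ~_W s` in `ω` and no vertex is `W`-linking,
then `d` has a `W`-neighbour `W`-rooted at `r` inside its block (no edge `r–s`). -/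
theorem exists_rooted_nbr (hrs : ∀ e, ends e ≠ s(r, s)) (hp : PureW ends r s d ω)
    (hc : Conn ends (OneColourSwitch.compl ω) r s) :
    ∃ x e, rootedW ends r s d ω r x ∧ ends e = s(x, d) ∧ ω e = false := by
  by_contra hno
  have hno' : ∀ x e, rootedW ends r s d ω r x → ends e = s(x, d) → ω e = false → False :=
    fun x e h1 h2 h3 => hno ⟨x, e, h1, h2, h3⟩
  have key : s ∈ {z | z = r ∨ rootedW ends r s d ω r z} := by
    refine mem_of_conn_of_closed (ends := ends) ?_ (Or.inl rfl) hc
    intro x hx y hxy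
    obtain ⟨hne, e, he, hends⟩ := openGraph_adj.1 hxy
    have hω : ω e = false := by simpa [OneColourSwitch.compl] using he
    rcases vertex_cases (ends := ends) (r := r) (s := s) (d := d) (ω := ω) y with
      hy | hy | hy | hyK | hyM | hyO
    · exact Or.inl hy
    · -- `y = s`: a block linking `r` and `s` or an edge `r–s`
      exfalso
      rcases hx with hx | ⟨hxM, hxc⟩
      · exact hrs e (by rw [hends, hx, hy])
      · refine hp x ⟨hxM, conn_trans hxc (conn_of_openAdj ⟨e, ?_, hy ▸ hends⟩)⟩
        rw [restrictTo_compl_eq (S := blockIn ends (Mcore ends r s d ω) x ∪ {r, s}) (Or.inl (mem_blockIn_self _ _)) (by simp) (hy ▸ hends), hω]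
        rfl
    · -- `y = d`: a rooted `W`-neighbour of `d`, excluded by `hno`
      exfalso
      rcases hx with hx | hxr
      · exact no_edge_d_term h (Or.inl hx) (ends_swap (hy ▸ hends))
      · exact hno' x e hxr (hy ▸ hends) hω
    · exfalso
      rcases hx with hx | ⟨hxM, _⟩
      · rw [edge_Kcore_term h hyK (Or.inl hx) (ends_swap hends)] at hω
        exact Bool.false_ne_true hω.symm
      · exact no_edge_core_core h hyK hxM (ends_swap hends)
    · right
      rcases hx with hx | ⟨hxM, hxc⟩
      · refine ⟨hyM, conn_of_openAdj ⟨e, ?_, hx ▸ hends⟩⟩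
        rw [restrictTo_compl_eq (S := blockIn ends (Mcore ends r s d ω) y ∪ {r, s}) (by simp) (Or.inl (mem_blockIn_self _ _)) (hx ▸ hends), hω]
        rfl
      · have hblk := blockIn_eq_of_Mcore_edge hxM hyM hends
        refine ⟨hyM, ?_⟩
        rw [← hblk]
        refine conn_trans hxc (conn_of_openAdj ⟨e, ?_, hends⟩)
        rw [restrictTo_compl_eq (S := blockIn ends (Mcore ends r s d ω) x ∪ {r, s}) (Or.inl (mem_blockIn_self _ _)) (Or.inl (hblk ▸ mem_blockIn_self _ _)) hends, hω]
        rfl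
    · exfalso
      rcases hx with hx | ⟨hxM, _⟩
      · exact no_edge_out_term h hyO (Or.inl hx) hends
      · rw [edge_Mcore_out hxM hyO hends] at hω
        exact Bool.false_ne_true hω.symm
  rcases key with hk | hk
  · exact h.hrs hk.symm
  · exact term_not_mem_Mcore (Or.inr rfl) hk.1

/-- The mirror of `exists_rooted_nbr`: a `W`-neighbour of `d` rooted at `s`. -/
theorem exists_rooted_nbr_s (hrs : ∀ e, ends e ≠ s(r, s)) (hp : PureW ends r s d ω)
    (hc : Conn ends (OneColourSwitch.compl ω) r s) :
    ∃ x e, rootedW ends r s d ω s x ∧ ends e = s(x, d) ∧ ω e = false := by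
  by_contra hno
  have hno' : ∀ x e, rootedW ends r s d ω s x → ends e = s(x, d) → ω e = false → False :=
    fun x e h1 h2 h3 => hno ⟨x, e, h1, h2, h3⟩
  have key : r ∈ {z | z = s ∨ rootedW ends r s d ω s z} := by
    refine mem_of_conn_of_closed (ends := ends) ?_ (Or.inl rfl) (conn_symm hc)
    intro x hx y hxy
    obtain ⟨hne, e, he, hends⟩ := openGraph_adj.1 hxy
    have hω : ω e = false := by simpa [OneColourSwitch.compl] using he
    rcases vertex_cases (ends := ends) (r := r) (s := s) (d := d) (ω := ω) y with
      hy | hy | hy | hyK | hyM | hyO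
    · exfalso
      rcases hx with hx | ⟨hxM, hxc⟩
      · exact hrs e (by rw [hends, hx, hy, Sym2.eq_swap])
      · refine hp x ⟨hxM, ?_⟩
        have hxr : Conn ends (restrictTo ends (OneColourSwitch.compl ω)
            (blockIn ends (Mcore ends r s d ω) x ∪ {r, s})) x r := by
          refine conn_of_openAdj ⟨e, ?_, hy ▸ hends⟩
          rw [restrictTo_compl_eq (S := blockIn ends (Mcore ends r s d ω) x ∪ {r, s}) (Or.inl (mem_blockIn_self _ _)) (by simp) (hy ▸ hends), hω]
          rfl
        exact conn_symm (conn_trans hxc hxr)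
    · exact Or.inl hy
    · exfalso
      rcases hx with hx | hxr
      · exact no_edge_d_term h (Or.inr hx) (ends_swap (hy ▸ hends))
      · exact hno' x e hxr (hy ▸ hends) hω
    · exfalso
      rcases hx with hx | ⟨hxM, _⟩
      · rw [edge_Kcore_term h hyK (Or.inr hx) (ends_swap hends)] at hω
        exact Bool.false_ne_true hω.symm
      · exact no_edge_core_core h hyK hxM (ends_swap hends)
    · right
      rcases hx with hx | ⟨hxM, hxc⟩
      · refine ⟨hyM, conn_of_openAdj ⟨e, ?_, hx ▸ hends⟩⟩
        rw [restrictTo_compl_eq (S := blockIn ends (Mcore ends r s d ω) y ∪ {r, s}) (by simp) (Or.inl (mem_blockIn_self _ _)) (hx ▸ hends), hω]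
        rfl
      · have hblk := blockIn_eq_of_Mcore_edge hxM hyM hends
        refine ⟨hyM, ?_⟩
        rw [← hblk]
        refine conn_trans hxc (conn_of_openAdj ⟨e, ?_, hends⟩)
        rw [restrictTo_compl_eq (S := blockIn ends (Mcore ends r s d ω) x ∪ {r, s}) (Or.inl (mem_blockIn_self _ _)) (Or.inl (hblk ▸ mem_blockIn_self _ _)) hends, hω]
        rfl
    · exfalso
      rcases hx with hx | ⟨hxM, _⟩
      · exact no_edge_out_term h hyO (Or.inr hx) hends
      · rw [edge_Mcore_out hxM hyO hends] at hω
        exact Bool.false_ne_true hω.symm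
  rcases key with hk | hk
  · exact h.hrs hk
  · exact term_not_mem_Mcore (Or.inl rfl) hk.1

/-- **The pure case**: `r ~_Y s` in `Ψ₂ ω` through `d` (no edge `r–s`, `r ~_W s` in `ω`). -/
theorem conn_psiTwo_of_pure (hrs : ∀ e, ends e ≠ s(r, s)) (hp : PureW ends r s d ω)
    (hc : Conn ends (OneColourSwitch.compl ω) r s) :
    Conn ends (psiTwo ends r s d ω) r s := by
  -- `d` is `Y`-connected to its root in `Ψ₂ ω`; the neighbour rooted at the opposite root
  -- carries the other half
  have hdK := h.inK
  by_cases hdr : Conn ends ω d r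
  · -- `oppRoot = s`
    have hopp : oppRoot ends r s d ω = s := by unfold oppRoot; rw [if_pos hdr]
    obtain ⟨x, e, hx, hends, hω⟩ := exists_rooted_nbr_s h hrs hp hc
    have hxJ : x ∈ joinedW ends r s d ω := mem_joinedW_of_nbr hx.1 (ends_swap hends)
    have hdx : Conn ends (psiTwo ends r s d ω) d x := by
      refine conn_of_openAdj ⟨e, ?_, ends_swap hends⟩
      exact psiTwo_d_opp_eq_true h hp hxJ (ends_swap hends) (by rw [hopp]; exact hx)
    have hxs : Conn ends (psiTwo ends r s d ω) s x :=
      conn_psiTwo_of_rootedW h hrs (Or.inl hxJ) hx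
    have hrd : Conn ends (psiTwo ends r s d ω) r d :=
      conn_psiTwo_of_conn h (conn_symm hdr) d_not_mem_Mcore (fun hO => hO.1 hdK)
    exact conn_trans hrd (conn_trans hdx (conn_symm hxs))
  · -- `oppRoot = r`; `d` is `Y`-connected to `s`
    have hopp : oppRoot ends r s d ω = r := by unfold oppRoot; rw [if_neg hdr]
    have hds : Conn ends ω d s := by
      rcases mem_K2_iff.1 hdK with hc' | hc'
      · exact (hdr (conn_symm hc')).elim
      · exact conn_symm hc'
    obtain ⟨x, e, hx, hends, hω⟩ := exists_rooted_nbr h hrs hp hc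
    have hxJ : x ∈ joinedW ends r s d ω := mem_joinedW_of_nbr hx.1 (ends_swap hends)
    have hdx : Conn ends (psiTwo ends r s d ω) d x := by
      refine conn_of_openAdj ⟨e, ?_, ends_swap hends⟩
      exact psiTwo_d_opp_eq_true h hp hxJ (ends_swap hends) (by rw [hopp]; exact hx)
    have hxr : Conn ends (psiTwo ends r s d ω) r x :=
      conn_psiTwo_of_rootedW h hrs (Or.inl hxJ) hx
    have hsd : Conn ends (psiTwo ends r s d ω) s d :=
      conn_psiTwo_of_conn h (conn_symm hds) d_not_mem_Mcore (fun hO => hO.1 hdK)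
    exact conn_symm (conn_trans hsd (conn_trans hdx (conn_symm hxr)))

/-- **`Ψ₂ ω` has a `Y`-link** (no edge `r–s`, `r ~_W s` in `ω`). -/
theorem conn_psiTwo_rs (hrs : ∀ e, ends e ≠ s(r, s))
    (hc : Conn ends (OneColourSwitch.compl ω) r s) :
    Conn ends (psiTwo ends r s d ω) r s := by
  by_cases hp : PureW ends r s d ω
  · exact conn_psiTwo_of_pure h hrs hp hc
  · obtain ⟨x, hx⟩ := not_forall.mp hp
    exact conn_psiTwo_of_linkingW h hrs (not_not.mp hx)

/-- **`σ_rs(Ψ₂ ω) = +1`** (no edge `r–s`, `r ~_W s` in `ω`). -/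
theorem sigma_psiTwo_rs (hrs : ∀ e, ends e ≠ s(r, s))
    (hc : Conn ends (OneColourSwitch.compl ω) r s) :
    sigma ends (psiTwo ends r s d ω) r s = 1 := by
  unfold sigma
  rw [if_pos (conn_psiTwo_rs h hrs hc), if_neg (not_conn_compl_psiTwo h hrs)]
  rfl

end Link

end NoPocket

end Summit.Ventures.PercRepro2
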